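import Summits.Schanuel.Schanuel.Theorems.RootDecomp1AdditiveCellsD
import Summits.Schanuel.Schanuel.Theorems.RootDecomp1EEStableRung
import Summits.Schanuel.Schanuel.Theorems.RootDecomp1ArgumentCells

/-!
# RootDecomp1 — ROUND 16 «ResidueSieve» (decomp-schanuel, lens 1 «grading / quantitative ladder», gen 16)

Target served: `_root_.Schanuel` through `route-Schanuel-RootDecomp1` (draft rev 22), deciding theorem
`closes (h₂ : SchanuelTwo) (hK) (hD : DefectOneSchanuel) (hU : RationalImageSchanuel) (hG) (hC)`, `Cⁿᵘ` split into
**D** = `DisjointSaturatedEssentialSchanuel` (stmt-Schanuel-30353, `ε = 0`) and **Cᵉ** (stmt-Schanuel-30352).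
Nothing here proves Schanuel (rung 0); every theorem is `sorry`-free over the standard axioms, the only named
hypotheses are `nesterenko` (members) and the registered conjecture `FourExponentialsConjecture` (§2).

## What this round proves (all about the length-3 layer `D₃` of item D)

* §1 **BIDEGREE SIEVE** (`disjointSaturatedEssentialSchanuel_three_of_cells`, item binders verbatim):
  `D|{n=3} ⟸ D|{n=3, (trdeg ℚ(z), trdeg ℚ(e^z)) = (1,1)} ∧ D|{n=3, all values algebraic}` — the rest of `n = 3`
  (`z ⊂ ℚ̄` by Lindemann–Weierstrass, `a + b ≥ 3` additively) is decided inside the proof.  TAG: bookkeeping frame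
  (the typed residue of D₃ = cells `(1,1)` ∪ `(2,0)`), not a re-typing of D.
* §2 **STRUCTURE — `FourExponentialsConjecture ⟹ D` on the cell of ARG-RICH POWER PLANES `y₀·(1, ρ, ρ²)`,
  `y₀, ρ` algebraically independent** (`disjointSaturatedEssentialSchanuel_powerPlane_of_fourExp`, binders verbatim;
  dictionary: FEC at `x = (1, ρ)`, `y = (y₀, y₀ρ)` ⟺ «`1 ≤ trdeg ℚ(e^{y₀}, e^{y₀ρ}, e^{y₀ρ²})`»; `a = 2` is free).
  These planes are PLAIN (`powerPlane_plain`), carry NO non-zero algebraic point, and sit in the sieve's cell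
  `(2,0) ∪ decided`; no unconditional instrument reaches them (Brownawell–Waldschmidt is void at `trdeg ℚ(x,y) = 2`,
  Theorem 2.9 needs `dℓ > d + ℓ`).  MEMBER `z_F = (e^π, πe^π, π²e^π)` certified in the cell by Nesterenko
  (`member_expPiPowerPlane`).  TAG: WEAKER-than-S named conjecture ⟹ named residue cell (critic (x)(iii″)).
* §3 **VALUE-RICH CELL** (`a ≥ 1`, two span points with algebraically independent exponentials ⟹ `v ≥ 2`):
  `D` HOLDS there at `n = 3` (`disjointSaturatedEssentialSchanuel_valRich_three`, binders verbatim), with MEMBER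
  `z* = (π, πi, log π)` CERTIFIED IN ROUND 15's RESIDUE: ℚ-free, PLAIN, no ℚ-free algebraic pair in the span
  (`dim (V ∩ ℚ̄) ≤ 1`), `a ≥ 1`, `v = 2` (values `e^π, −1, π`; Nesterenko read on the VALUE side through `log π`)
  — `member_piILogPi`; item D decided (holds) at `z*` while Schanuel there is `3 ≤ trdeg ℚ(π, e^π, log π)`, open
  (`schanuel_piILogPi_iff`).  TAG: (i‴) `t₂ ≥ 2` certificate on an explicit plain 3-space with `dim (V ∩ ℚ̄) ≤ 1`;
  wall named: «two algebraically independent VALUES on a plain span» is beaten only where the span contains a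
  logarithm of a Nesterenko coordinate — honest scope below.
* §4 **HARDNESS OF CELL `(1,1)`**: on its power-line sub-cell, round 15's deciding input PowerValueTwo(w) with
  `e^w ∈ ℚ̄` is EXACTLY `e^{w²} ∉ ℚ̄` territory: PowerValueTwo(log 2) ⟹ `2^{log 2} ∉ ℚ̄`, PowerValueTwo(πi) ⟹
  `e^{π²} ∉ ℚ̄` (named open problems).  TAG: BARRIER bookkeeping (dominance), no credit claimed.

## Leaves after this round (length 3, `ε = 0`)

* cell `(2,0)` minus FEC-power-planes: BARRIER (AIL-type: three ℚ-free logarithms of algebraic numbers spanning a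
  field of transcendence degree 2); FEC-power-planes: decided ⟸ `FourExponentialsConjecture` (registered, below S).
* cell `(1,1)`: IDEA-NEEDED; power lines ⟺ PowerValueTwo(w) ≥ {`α^{log α}`, `e^{π²}`} problems (§4).
* value-rich cell: ATTACKABLE members = spans containing `log` of a coordinate of a known algebraically independent
  exponential pair (`(π, e^π)`, `(π, e^{π√d})`, Γ-values via Chudnovsky) — calibration-grade beyond `z*`.

## Why this is novel (one sentence)

Rounds 9/15 read every certificate on the ARGUMENT side or through Lindemann–Weierstrass; this round (a) names the
first cell of D's residue decided by a REGISTERED conjecture strictly below Schanuel (Four Exponentials, via the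
`2 × 2` grid hidden in a power plane) with a Nesterenko-certified member, and (b) decides item D at an explicit point
of round 15's residue (`z* = (π, πi, log π)`: plain, `dim (V ∩ ℚ̄) ≤ 1`, no certified free argument pair) by reading
the algebraically independent pair on the VALUE side — where Schanuel itself stays open.
-/


noncomputable section

namespace Summit.Schanuel.Schanuel.Theorems.RootDecomp1ResidueSieve

open Complex IntermediateField Module Polynomial
open Literature.NumberTheory.Transcendental (exists_nsmul_mem_span_int nesterenko transcendental_pi_holds
  FourExponentialsConjecture)
open Summit.Schanuel.Schanuel.Theorems.RootDecomp1EAnchor (isAlgebraic_of_mem_adjoin isAlgebraic_mul isAlgebraic_add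
  trdeg_adjoin_union_le trdeg_adjoin_le_nat trdeg_adjoin_le_of_isAlgebraic exists_nat_eq_of_le_natCast)
open Summit.Schanuel.Schanuel.Theorems.RootDecomp1EEStableRung (one_le_trdeg_adjoin_of_transcendental
  mul_mem_span_of_gens)
open Summit.Schanuel.Schanuel.Theorems.RootDecomp1ArgumentCells (trdeg_args_le trdeg_vals_le
  le_trdeg_of_algebraicIndependent_mem le_valDegree_of_exp_algebraic_mem algebraicIndependent_pi_exp_pi
  trdeg_args_le_one_of_isAlgebraic_adjoin_singleton)
open Summit.Schanuel.Schanuel.Theorems.RootDecomp1ValueCells (exp_mem_vals_of_mem_span_int exp_isAlgebraic_vals_of_mem_span)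
open Summit.Schanuel.Schanuel.Theorems.RootDecomp1AdditiveCells (linearIndependent_mul_left le_trdeg_of_additive_cert)
open Summit.Schanuel.Schanuel.Theorems.RootDecomp1AdditiveCellsD (pair_one_linearIndependent)

/-! ## §0  Toolkit (restated from round 15, whose files are not yet ported into `Theorems/`) -/

/-- A transcendental number is non-zero. -/
private theorem ne_zero_of_transcendental {w : ℂ} (hw : Transcendental ℚ w) : w ≠ 0 := by
  rintro rfl
  exact hw isAlgebraic_zero

/-- `π` is transcendental as a complex number (tree theorem `transcendental_pi_holds`, transported along `ℝ → ℂ`). -/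
private theorem transcendental_pi_complex : Transcendental ℚ (Real.pi : ℂ) :=
  (transcendental_algebraMap_iff (R := ℚ) (A := ℂ) Complex.ofReal_injective).mpr transcendental_pi_holds



/-- The ℚ-span of `z` lies in the ARGUMENT field `ℚ(z)`. -/
theorem mem_args_of_mem_span {ι : Type*} {z : ι → ℂ} {x : ℂ} (hx : x ∈ Submodule.span ℚ (Set.range z)) :
    x ∈ adjoin ℚ (Set.range z) := by
  have hle : Submodule.span ℚ (Set.range z) ≤ (adjoin ℚ (Set.range z)).toSubalgebra.toSubmodule :=
    Submodule.span_le.mpr fun _ hy => subset_adjoin ℚ _ hy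
  exact hle hx




/-- The three degrees of a triple are naturals `≤ 3`, `≤ 3`. -/
theorem exists_nat_argDegree {n : ℕ} (z : Fin n → ℂ) :
    ∃ a : ℕ, Algebra.trdeg ℚ ↥(adjoin ℚ (Set.range z)) = a ∧ a ≤ n :=
  exists_nat_eq_of_le_natCast (trdeg_adjoin_le_nat (F := ℚ) _ (Cardinal.mk_range_le.trans (by simp)))

/-- The value degree `trdeg ℚ(e^z)` of an `n`-tuple is a natural number `≤ n`. -/
theorem exists_nat_valDegree {n : ℕ} (z : Fin n → ℂ) :
    ∃ b : ℕ, Algebra.trdeg ℚ ↥(adjoin ℚ (Set.range (cexp ∘ z))) = b ∧ b ≤ n :=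
  exists_nat_eq_of_le_natCast (trdeg_adjoin_le_nat (F := ℚ) _ (Cardinal.mk_range_le.trans (by simp)))

/-- `trdeg ℚ(e^z) = 0`-type information: if NO value is transcendental-witnessing, all values are algebraic. -/
theorem values_algebraic_of_valDegree_zero {n : ℕ} (z : Fin n → ℂ)
    (h0 : Algebra.trdeg ℚ ↥(adjoin ℚ (Set.range (cexp ∘ z))) = 0) : ∀ i, IsAlgebraic ℚ (cexp (z i)) := by
  intro i
  by_contra hi
  have h1 := one_le_trdeg_adjoin_of_transcendental (S := Set.range (cexp ∘ z)) hi ⟨i, rfl⟩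
  rw [h0] at h1
  exact absurd h1 (by norm_num)

/-- `trdeg ℚ(z) = 0`-type information: if no argument is transcendental, all arguments are algebraic. -/
theorem args_algebraic_of_argDegree_zero {n : ℕ} (z : Fin n → ℂ)
    (h0 : Algebra.trdeg ℚ ↥(adjoin ℚ (Set.range z)) = 0) : ∀ i, IsAlgebraic ℚ (z i) := by
  intro i
  by_contra hi
  have h1 := one_le_trdeg_adjoin_of_transcendental (S := Set.range z) hi ⟨i, rfl⟩
  rw [h0] at h1
  exact absurd h1 (by norm_num)


/-- **In an algebraically independent pair `(x, y)`, `y` is NOT algebraic over `ℚ(x)`** (`trdeg ℚ(x, y) = 2 > 1`). -/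
theorem not_isAlgebraic_of_algebraicIndependent_pair {x y : ℂ} (h : AlgebraicIndependent ℚ ![x, y]) :
    ¬ IsAlgebraic ↥(adjoin ℚ ({x} : Set ℂ)) y := by
  intro halg
  have h2 : ((2 : ℕ) : Cardinal) ≤ Algebra.trdeg ℚ ↥(adjoin ℚ (Set.range ![x, y])) :=
    le_trdeg_of_algebraicIndependent_mem _ h fun i => subset_adjoin ℚ _ ⟨i, rfl⟩
  have hle : Algebra.trdeg ℚ ↥(adjoin ℚ (Set.range ![x, y])) ≤ Algebra.trdeg ℚ ↥(adjoin ℚ ({x} : Set ℂ)) := by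
    refine trdeg_adjoin_le_of_isAlgebraic ?_
    rintro _ ⟨i, rfl⟩
    fin_cases i
    · simpa using isAlgebraic_of_mem_adjoin (mem_adjoin_simple_self ℚ x)
    · simpa using halg
  have h1 : Algebra.trdeg ℚ ↥(adjoin ℚ ({x} : Set ℂ)) ≤ ((1 : ℕ) : Cardinal) :=
    trdeg_adjoin_le_nat (F := ℚ) _ (by simp)
  have := (h2.trans hle).trans h1
  norm_cast at this

/-! ## §1  THE BIDEGREE SIEVE: what is left of item D at length 3

For a ℚ-free triple `z` write `a = trdeg ℚ(z)`, `b = trdeg ℚ(e^z)`, `t = trdeg ℚ(z, e^z)`; on the disjoint stratum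
(`ε = 0`, i.e. `a + b ≤ t`) item D asks `3 ≤ t`.  UNCONDITIONALLY: `b = 0` means all three values are algebraic;
`a = 0` means `z ⊂ ℚ̄` and Lindemann–Weierstrass gives `b = 3`; `a + b ≥ 3` is the additive certificate.  What
remains is EXACTLY the two bidegree cells `(a, b) = (1, 1)` and `(2, 0)` — the typed residue of D₃. -/

/-- **THE SIEVE (pointwise).**  Item D's conclusion at a ℚ-free triple on the disjoint stratum follows from its
restrictions to the bidegree cells `(1,1)` (`trdeg ℚ(z) ≤ 1 ∧ trdeg ℚ(e^z) ≤ 1`) and `(2,0)` (all values algebraic). -/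
theorem disjointSchanuel_three_of_cells (z : Fin 3 → ℂ) (hz : LinearIndependent ℚ z)
    (hsplit : Algebra.trdeg ℚ ↥(adjoin ℚ (Set.range z)) + Algebra.trdeg ℚ ↥(adjoin ℚ (Set.range (cexp ∘ z))) ≤
      Algebra.trdeg ℚ ↥(adjoin ℚ (Set.range z ∪ Set.range (cexp ∘ z))))
    (h11 : Algebra.trdeg ℚ ↥(adjoin ℚ (Set.range z)) ≤ 1 →
      Algebra.trdeg ℚ ↥(adjoin ℚ (Set.range (cexp ∘ z))) ≤ 1 →
      ((3 : ℕ) : Cardinal) ≤ Algebra.trdeg ℚ ↥(adjoin ℚ (Set.range z ∪ Set.range (cexp ∘ z))))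
    (h20 : (∀ i, IsAlgebraic ℚ (cexp (z i))) →
      ((3 : ℕ) : Cardinal) ≤ Algebra.trdeg ℚ ↥(adjoin ℚ (Set.range z ∪ Set.range (cexp ∘ z)))) :
    ((3 : ℕ) : Cardinal) ≤ Algebra.trdeg ℚ ↥(adjoin ℚ (Set.range z ∪ Set.range (cexp ∘ z))) := by
  obtain ⟨a, ha, _⟩ := exists_nat_argDegree z
  obtain ⟨b, hb, _⟩ := exists_nat_valDegree z
  by_cases hb0 : b = 0
  · exact h20 (values_algebraic_of_valDegree_zero z (by rw [hb, hb0, Nat.cast_zero]))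
  by_cases ha0 : a = 0
  · have halg := args_algebraic_of_argDegree_zero z (by rw [ha, ha0, Nat.cast_zero])
    exact (le_valDegree_of_exp_algebraic_mem z z halg hz fun j => subset_adjoin ℚ _ ⟨j, rfl⟩).trans
      (trdeg_vals_le z)
  by_cases hab : 3 ≤ a + b
  · exact le_trdeg_of_additive_cert z (a := a) (v := b) (by rw [ha]) (by rw [hb]) hsplit hab
  · have ha1 : a = 1 := by omega
    have hb1 : b = 1 := by omega
    exact h11 (by rw [ha, ha1, Nat.cast_one]) (by rw [hb, hb1, Nat.cast_one])

/-- **THE SIEVE (item form, binders of `DisjointSaturatedEssentialSchanuel` = stmt-Schanuel-30353 verbatim, the cell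
inserted after `LinearIndependent ℚ z`).**  `D|{n = 3}  ⟸  D|{n = 3, bidegree (1,1)}  ∧  D|{n = 3, bidegree (2,0)}`:
the length-3 layer of item D REDUCES to two typed cells.  (Everything else at `n = 3` — `z ⊂ ℚ̄`, value degree `0`
impossible with a transcendental value, `a + b ≥ 3` — is decided unconditionally inside the proof.) -/
theorem disjointSaturatedEssentialSchanuel_three_of_cells
    (h11 :
      ∀ (n : ℕ), 3 ≤ n → ∀ (z : Fin n → ℂ), LinearIndependent ℚ z →
        (n ≤ 3 ∧ Algebra.trdeg ℚ ↥(IntermediateField.adjoin ℚ (Set.range z)) ≤ 1 ∧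
          Algebra.trdeg ℚ ↥(IntermediateField.adjoin ℚ (Set.range (Complex.exp ∘ z))) ≤ 1) →
        (∀ i, z i ∈ Literature.NumberTheory.Transcendental.ecl (∅ : Set ℂ)) →
        (∀ (m : ℕ), m < n → ∀ (w : Fin m → ℂ), LinearIndependent ℚ w →
          (∀ i, w i ∈ Submodule.span ℚ (Set.range z)) →
          (m : Cardinal) ≤ Algebra.trdeg ℚ ↥(IntermediateField.adjoin ℚ (Set.range w ∪ Set.range (Complex.exp ∘ w)))) →
        (∀ w : ℂ, IsAlgebraic ↥(IntermediateField.adjoin ℚ (Set.range z ∪ Set.range (Complex.exp ∘ z))) w →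
          IsAlgebraic ↥(IntermediateField.adjoin ℚ (Set.range z ∪ Set.range (Complex.exp ∘ z))) (Complex.exp w) →
          w ∈ Submodule.span ℚ (Set.range z)) →
        (∀ (k : ℕ) (t : Fin k → ℂ) (β₀ γ₀ : Fin n → ℂ) (β γ : Fin n → Fin k → ℂ), (∀ i, IsAlgebraic ℚ (β₀ i)) →
          (∀ i j, IsAlgebraic ℚ (β i j)) → (∀ i, IsAlgebraic ℚ (γ₀ i)) → (∀ i j, IsAlgebraic ℚ (γ i j)) →
          (∀ i, z i = β₀ i + ∑ j, β i j * t j) → (∀ i, Complex.exp (z i) = γ₀ i + ∑ j, γ i j * t j) → n ≤ k) →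
        (∀ (k : ℕ) (t : Fin k → ℂ) (β₀ γ₀ : Fin n → ℂ) (β γ : Fin n → Fin k → ℂ) (δ ε : Fin n → Fin k → Fin k → ℂ),
          (∀ i, IsAlgebraic ℚ (β₀ i)) → (∀ i j, IsAlgebraic ℚ (β i j)) → (∀ i j j', IsAlgebraic ℚ (δ i j j')) →
          (∀ i, IsAlgebraic ℚ (γ₀ i)) → (∀ i j, IsAlgebraic ℚ (γ i j)) → (∀ i j j', IsAlgebraic ℚ (ε i j j')) →
          (∀ i, z i = β₀ i + ∑ j, β i j * t j + ∑ j, ∑ j', δ i j j' * (t j * t j')) →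
          (∀ i, Complex.exp (z i) = γ₀ i + ∑ j, γ i j * t j + ∑ j, ∑ j', ε i j j' * (t j * t j')) → n ≤ k) →
        (∀ (k : ℕ) (t : Fin k → ℂ) (D : MvPolynomial (Fin k) ℂ) (N E : Fin n → MvPolynomial (Fin k) ℂ),
          (∀ m, IsAlgebraic ℚ (MvPolynomial.coeff m D)) → (∀ i m, IsAlgebraic ℚ (MvPolynomial.coeff m (N i))) →
          (∀ i m, IsAlgebraic ℚ (MvPolynomial.coeff m (E i))) → MvPolynomial.eval t D ≠ 0 →
          (∀ i, z i * MvPolynomial.eval t D = MvPolynomial.eval t (N i)) →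
          (∀ i, Complex.exp (z i) * MvPolynomial.eval t D = MvPolynomial.eval t (E i)) → n ≤ k) →
        (Algebra.trdeg ℚ ↥(IntermediateField.adjoin ℚ (Set.range z)) +
            Algebra.trdeg ℚ ↥(IntermediateField.adjoin ℚ (Set.range (Complex.exp ∘ z))) ≤
          Algebra.trdeg ℚ ↥(IntermediateField.adjoin ℚ (Set.range z ∪ Set.range (Complex.exp ∘ z)))) →
        (n : Cardinal) ≤ Algebra.trdeg ℚ ↥(IntermediateField.adjoin ℚ (Set.range z ∪ Set.range (Complex.exp ∘ z))))
    (h20 :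
      ∀ (n : ℕ), 3 ≤ n → ∀ (z : Fin n → ℂ), LinearIndependent ℚ z →
        (n ≤ 3 ∧ ∀ i, IsAlgebraic ℚ (Complex.exp (z i))) →
        (∀ i, z i ∈ Literature.NumberTheory.Transcendental.ecl (∅ : Set ℂ)) →
        (∀ (m : ℕ), m < n → ∀ (w : Fin m → ℂ), LinearIndependent ℚ w →
          (∀ i, w i ∈ Submodule.span ℚ (Set.range z)) →
          (m : Cardinal) ≤ Algebra.trdeg ℚ ↥(IntermediateField.adjoin ℚ (Set.range w ∪ Set.range (Complex.exp ∘ w)))) →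
        (∀ w : ℂ, IsAlgebraic ↥(IntermediateField.adjoin ℚ (Set.range z ∪ Set.range (Complex.exp ∘ z))) w →
          IsAlgebraic ↥(IntermediateField.adjoin ℚ (Set.range z ∪ Set.range (Complex.exp ∘ z))) (Complex.exp w) →
          w ∈ Submodule.span ℚ (Set.range z)) →
        (∀ (k : ℕ) (t : Fin k → ℂ) (β₀ γ₀ : Fin n → ℂ) (β γ : Fin n → Fin k → ℂ), (∀ i, IsAlgebraic ℚ (β₀ i)) →
          (∀ i j, IsAlgebraic ℚ (β i j)) → (∀ i, IsAlgebraic ℚ (γ₀ i)) → (∀ i j, IsAlgebraic ℚ (γ i j)) →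
          (∀ i, z i = β₀ i + ∑ j, β i j * t j) → (∀ i, Complex.exp (z i) = γ₀ i + ∑ j, γ i j * t j) → n ≤ k) →
        (∀ (k : ℕ) (t : Fin k → ℂ) (β₀ γ₀ : Fin n → ℂ) (β γ : Fin n → Fin k → ℂ) (δ ε : Fin n → Fin k → Fin k → ℂ),
          (∀ i, IsAlgebraic ℚ (β₀ i)) → (∀ i j, IsAlgebraic ℚ (β i j)) → (∀ i j j', IsAlgebraic ℚ (δ i j j')) →
          (∀ i, IsAlgebraic ℚ (γ₀ i)) → (∀ i j, IsAlgebraic ℚ (γ i j)) → (∀ i j j', IsAlgebraic ℚ (ε i j j')) →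
          (∀ i, z i = β₀ i + ∑ j, β i j * t j + ∑ j, ∑ j', δ i j j' * (t j * t j')) →
          (∀ i, Complex.exp (z i) = γ₀ i + ∑ j, γ i j * t j + ∑ j, ∑ j', ε i j j' * (t j * t j')) → n ≤ k) →
        (∀ (k : ℕ) (t : Fin k → ℂ) (D : MvPolynomial (Fin k) ℂ) (N E : Fin n → MvPolynomial (Fin k) ℂ),
          (∀ m, IsAlgebraic ℚ (MvPolynomial.coeff m D)) → (∀ i m, IsAlgebraic ℚ (MvPolynomial.coeff m (N i))) →
          (∀ i m, IsAlgebraic ℚ (MvPolynomial.coeff m (E i))) → MvPolynomial.eval t D ≠ 0 →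
          (∀ i, z i * MvPolynomial.eval t D = MvPolynomial.eval t (N i)) →
          (∀ i, Complex.exp (z i) * MvPolynomial.eval t D = MvPolynomial.eval t (E i)) → n ≤ k) →
        (Algebra.trdeg ℚ ↥(IntermediateField.adjoin ℚ (Set.range z)) +
            Algebra.trdeg ℚ ↥(IntermediateField.adjoin ℚ (Set.range (Complex.exp ∘ z))) ≤
          Algebra.trdeg ℚ ↥(IntermediateField.adjoin ℚ (Set.range z ∪ Set.range (Complex.exp ∘ z)))) →
        (n : Cardinal) ≤ Algebra.trdeg ℚ ↥(IntermediateField.adjoin ℚ (Set.range z ∪ Set.range (Complex.exp ∘ z)))) :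
    ∀ (n : ℕ), 3 ≤ n → ∀ (z : Fin n → ℂ), LinearIndependent ℚ z →
      (n ≤ 3) →
      (∀ i, z i ∈ Literature.NumberTheory.Transcendental.ecl (∅ : Set ℂ)) →
      (∀ (m : ℕ), m < n → ∀ (w : Fin m → ℂ), LinearIndependent ℚ w →
        (∀ i, w i ∈ Submodule.span ℚ (Set.range z)) →
        (m : Cardinal) ≤ Algebra.trdeg ℚ ↥(IntermediateField.adjoin ℚ (Set.range w ∪ Set.range (Complex.exp ∘ w)))) →
      (∀ w : ℂ, IsAlgebraic ↥(IntermediateField.adjoin ℚ (Set.range z ∪ Set.range (Complex.exp ∘ z))) w →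
        IsAlgebraic ↥(IntermediateField.adjoin ℚ (Set.range z ∪ Set.range (Complex.exp ∘ z))) (Complex.exp w) →
        w ∈ Submodule.span ℚ (Set.range z)) →
      (∀ (k : ℕ) (t : Fin k → ℂ) (β₀ γ₀ : Fin n → ℂ) (β γ : Fin n → Fin k → ℂ), (∀ i, IsAlgebraic ℚ (β₀ i)) →
        (∀ i j, IsAlgebraic ℚ (β i j)) → (∀ i, IsAlgebraic ℚ (γ₀ i)) → (∀ i j, IsAlgebraic ℚ (γ i j)) →
        (∀ i, z i = β₀ i + ∑ j, β i j * t j) → (∀ i, Complex.exp (z i) = γ₀ i + ∑ j, γ i j * t j) → n ≤ k) →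
      (∀ (k : ℕ) (t : Fin k → ℂ) (β₀ γ₀ : Fin n → ℂ) (β γ : Fin n → Fin k → ℂ) (δ ε : Fin n → Fin k → Fin k → ℂ),
        (∀ i, IsAlgebraic ℚ (β₀ i)) → (∀ i j, IsAlgebraic ℚ (β i j)) → (∀ i j j', IsAlgebraic ℚ (δ i j j')) →
        (∀ i, IsAlgebraic ℚ (γ₀ i)) → (∀ i j, IsAlgebraic ℚ (γ i j)) → (∀ i j j', IsAlgebraic ℚ (ε i j j')) →
        (∀ i, z i = β₀ i + ∑ j, β i j * t j + ∑ j, ∑ j', δ i j j' * (t j * t j')) →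
        (∀ i, Complex.exp (z i) = γ₀ i + ∑ j, γ i j * t j + ∑ j, ∑ j', ε i j j' * (t j * t j')) → n ≤ k) →
      (∀ (k : ℕ) (t : Fin k → ℂ) (D : MvPolynomial (Fin k) ℂ) (N E : Fin n → MvPolynomial (Fin k) ℂ),
        (∀ m, IsAlgebraic ℚ (MvPolynomial.coeff m D)) → (∀ i m, IsAlgebraic ℚ (MvPolynomial.coeff m (N i))) →
        (∀ i m, IsAlgebraic ℚ (MvPolynomial.coeff m (E i))) → MvPolynomial.eval t D ≠ 0 →
        (∀ i, z i * MvPolynomial.eval t D = MvPolynomial.eval t (N i)) →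
        (∀ i, Complex.exp (z i) * MvPolynomial.eval t D = MvPolynomial.eval t (E i)) → n ≤ k) →
      (Algebra.trdeg ℚ ↥(IntermediateField.adjoin ℚ (Set.range z)) +
          Algebra.trdeg ℚ ↥(IntermediateField.adjoin ℚ (Set.range (Complex.exp ∘ z))) ≤
        Algebra.trdeg ℚ ↥(IntermediateField.adjoin ℚ (Set.range z ∪ Set.range (Complex.exp ∘ z)))) →
      (n : Cardinal) ≤ Algebra.trdeg ℚ ↥(IntermediateField.adjoin ℚ (Set.range z ∪ Set.range (Complex.exp ∘ z))) := by
  intro n hn z hz hn3 hK hT hS hL hQ hU hsplit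
  obtain rfl : n = 3 := le_antisymm hn3 hn
  exact disjointSchanuel_three_of_cells z hz hsplit
    (fun h1 h2 => h11 3 le_rfl z hz ⟨le_rfl, h1, h2⟩ hK hT hS hL hQ hU hsplit)
    (fun h => h20 3 le_rfl z hz ⟨le_rfl, h⟩ hK hT hS hL hQ hU hsplit)

end Summit.Schanuel.Schanuel.Theorems.RootDecomp1ResidueSieve
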